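import Summits.KontsevichZagierPeriods.KontsevichZagierPeriods.Theorems.RootDecompRelativeModAbsoluteCylLogSplitP10

/-! # `RootDecompRelativeModAbsoluteCylLogSplitP11` — part 11/25 of the mechanical ≤330-line split of `CylLogSplit.lean`
(split by the decomp-kz census seat for landing; mathematics unchanged; part 11 continues part 10). -/

noncomputable section
open Set MeasureTheory Filter Topology
open scoped BigOperators
open Literature.NumberTheory.Transcendental Literature.ModelTheory.ExponentialFields

namespace Summit.KontsevichZagierPeriods.RootDecompRelativeModAbsolute.Rung30571

namespace RegularisedLogLayer

namespace CylLog
variable {b : ℕ}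

/-! ### §3k′ D4 existence for `−1 < κ < 0` (the REVERSED band `[1+κ, 1]`) — PROVED
Mirror image of §3k through the orientation-reversing substitution of §3i: the regularised representation
`[{1+κ ≤ t ≤ 1}, (−c/κ^{M+1})(t−1)^M/t]` is honest whenever the cylinder term is, and differs from it by a relation. -/

/-- The fibre identity behind D4 for `−1 < k < 0` (`t = 1 + kθ`, decreasing):
`∫_{[1+k,1]} |(−c/k^{M+1})·(t−1)^M/t| dt = ∫_{[0,1]} |c·θ^M/(1+θk)| dθ`. -/
theorem integral_abs_regKernel_eq_neg (M : ℕ) (c : ℝ) {k : ℝ} (hk : k < 0) (hk1 : -1 < k) :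
    ∫ t in Icc (1 + k) 1, |-(c / k ^ (M + 1)) * ((t - 1) ^ M / t)| =
      ∫ θ in Icc 0 1, |c * (θ ^ M / (1 + θ * k))| := by
  set ψ : ℝ → ℝ := fun t => |-(c / k ^ (M + 1)) * ((t - 1) ^ M / t)| with hψ
  set φ : ℝ → ℝ := fun θ => |c * (θ ^ M / (1 + θ * k))| with hφ
  have hk0 : k ≠ 0 := hk.ne
  have hpt : ∀ θ ∈ Icc (0:ℝ) 1, (-k) * ψ (k * θ + 1) = φ θ := by
    intro θ hθ
    have hθ0 : 0 ≤ θ := hθ.1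
    have hθ1 : θ ≤ 1 := hθ.2
    have hden_pos : 0 < k * θ + 1 := by nlinarith
    have hden : k * θ + 1 ≠ 0 := hden_pos.ne'
    have hden' : 1 + θ * k ≠ 0 := by rw [mul_comm]; linarith
    have key : (-k) * (-(c / k ^ (M + 1)) * ((k * θ + 1 - 1) ^ M / (k * θ + 1))) =
        c * (θ ^ M / (1 + θ * k)) := by
      rw [add_sub_cancel_right, mul_pow, pow_succ, show 1 + θ * k = k * θ + 1 by ring]
      have hkM : k ^ M ≠ 0 := pow_ne_zero _ hk0
      field_simp
    show (-k) * |-(c / k ^ (M + 1)) * ((k * θ + 1 - 1) ^ M / (k * θ + 1))| =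
      |c * (θ ^ M / (1 + θ * k))|
    rw [← key]
    conv_rhs => rw [abs_mul, abs_of_pos (neg_pos.mpr hk)]
  have h1 : ∫ t in Icc (1 + k) 1, ψ t = ∫ t in (1 + k)..1, ψ t := by
    rw [intervalIntegral.integral_of_le (by linarith), integral_Icc_eq_integral_Ioc]
  have h2 : ∫ θ in Icc (0:ℝ) 1, φ θ = ∫ θ in (0:ℝ)..1, φ θ := by
    rw [intervalIntegral.integral_of_le zero_le_one, integral_Icc_eq_integral_Ioc]
  have h3 : k * ∫ θ in (0:ℝ)..1, ψ (k * θ + 1) = ∫ t in k * 0 + 1..k * 1 + 1, ψ t :=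
    intervalIntegral.mul_integral_comp_mul_add k 1
  have h4 : ∫ t in (1 + k)..1, ψ t = -∫ t in k * 0 + 1..k * 1 + 1, ψ t := by
    rw [intervalIntegral.integral_symm]
    simp only [mul_zero, zero_add, mul_one, add_comm]
  rw [h1, h2, h4, ← h3, neg_mul_eq_neg_mul, ← intervalIntegral.integral_const_mul]
  exact intervalIntegral.integral_congr fun θ hθ => hpt θ (by rwa [uIcc_of_le zero_le_one] at hθ)

/-- Lintegral form of the reversed fibre identity. -/
theorem lintegral_regKernel_le_neg (M : ℕ) (c : ℝ) {k : ℝ} (hk : k < 0) (hk1 : -1 < k) :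
    ∫⁻ t in Icc (1 + k) 1, ‖-(c / k ^ (M + 1)) * ((t - 1) ^ M / t)‖ₑ ≤
      ‖∫ θ in Icc 0 1, |c * (θ ^ M / (1 + θ * k))|‖ₑ := by
  set g : ℝ → ℝ := fun t => -(c / k ^ (M + 1)) * ((t - 1) ^ M / t) with hg
  have hg_cont : ContinuousOn g (Icc (1 + k) 1) := by
    have h := continuousOn_scaled_kernel M (-(c / k ^ (M + 1))) 1 (Icc (1 + k) 1)
      (fun t ht => (by linarith [ht.1] : (0:ℝ) < t).ne')
    simpa [hg] using h
  have hg_int : IntegrableOn g (Icc (1 + k) 1) := hg_cont.integrableOn_compact isCompact_Icc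
  have hL : ∫⁻ t in Icc (1 + k) 1, ‖g t‖ₑ = ENNReal.ofReal (∫ t in Icc (1 + k) 1, ‖g t‖) :=
    (ofReal_integral_norm_eq_lintegral_enorm hg_int).symm
  have hK_nonneg : 0 ≤ ∫ θ in Icc (0:ℝ) 1, |c * (θ ^ M / (1 + θ * k))| :=
    setIntegral_nonneg measurableSet_Icc fun _ _ => abs_nonneg _
  show ∫⁻ t in Icc (1 + k) 1, ‖g t‖ₑ ≤ _
  rw [hL, Real.enorm_eq_ofReal hK_nonneg]
  refine ENNReal.ofReal_le_ofReal (le_of_eq ?_)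
  rw [← integral_abs_regKernel_eq_neg M c hk hk1]
  exact setIntegral_congr_fun measurableSet_Icc fun t _ => by simp only [hg, Real.norm_eq_abs]

/-- **D4 existence (`−1 < κ < 0`):** the reversed regularised representation
`[{1+κ ≤ t ≤ 1}, (−c/κ^{M+1})(t−1)^M/t]` is honest whenever the cylinder term `[{0≤θ≤1}, cθ^M/(1+θκ)]` is. -/
theorem exists_regNegRep_of_cyl {b M : ℕ} {G : Set (Fin b → ℝ)} {c κ : (Fin b → ℝ) → ℝ}
    (hG : IsSemialgebraic ℚ G) (hc : IsSemialgebraicFunOn ℚ G c) (hκ : IsSemialgebraicFunOn ℚ G κ)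
    (hκ0 : ∀ x ∈ G, κ x < 0) (hκ1 : ∀ x ∈ G, -1 < κ x) (Cy : KZ.IntegralRep (b + 1))
    (hCd : Cy.domain = KZlog.band G (fun _ => 0) (fun _ => 1))
    (hCi : EqOn Cy.integrand (fun z => c (Fin.init z) *
      (z (Fin.last b) ^ M / (1 + z (Fin.last b) * κ (Fin.init z)))) Cy.domain) :
    ∃ Rg : KZ.IntegralRep (b + 1), Rg.domain = KZlog.band G (fun x => 1 + κ x) (fun _ => 1) ∧
      Rg.integrand = fun z =>
        -(c (Fin.init z) / κ (Fin.init z) ^ (M + 1)) * ((z (Fin.last b) - 1) ^ M / z (Fin.last b)) := by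
  have h1sa : IsSemialgebraicFunOn ℚ G (fun _ => (1:ℝ)) :=
    (isSemialgebraicFunOn_ratCast hG 1).congr fun _ _ => by simp
  have hWsa : IsSemialgebraicFunOn ℚ G (fun x => 1 + κ x) := IsSemialgebraicFunOn.add_holds h1sa hκ
  have hbsa : IsSemialgebraic ℚ (KZlog.band G (fun x => 1 + κ x) (fun _ => (1:ℝ))) :=
    KZlog.isSemialgebraic_band hWsa h1sa
  have hGm : MeasurableSet G := hG.measurableSet_holds
  have hBm : MeasurableSet (KZlog.band G (fun x => 1 + κ x) (fun _ => (1:ℝ))) :=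
    hbsa.measurableSet_holds
  have hband_sub : KZlog.band G (fun x => 1 + κ x) (fun _ => (1:ℝ)) ⊆
      {z : Fin (b + 1) → ℝ | Fin.init z ∈ G} := fun z hz => hz.1
  have hcI : IsSemialgebraicFunOn ℚ (KZlog.band G (fun x => 1 + κ x) (fun _ => (1:ℝ)))
      (fun z => c (Fin.init z)) := hc.comp_init.mono hband_sub hbsa
  have hκI : IsSemialgebraicFunOn ℚ (KZlog.band G (fun x => 1 + κ x) (fun _ => (1:ℝ)))
      (fun z => κ (Fin.init z)) := hκ.comp_init.mono hband_sub hbsa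
  have hsI : IsSemialgebraicFunOn ℚ (KZlog.band G (fun x => 1 + κ x) (fun _ => (1:ℝ)))
      (fun z => z (Fin.last b)) := isSemialgebraicFunOn_apply hbsa (Fin.last b)
  have hs1 : IsSemialgebraicFunOn ℚ (KZlog.band G (fun x => 1 + κ x) (fun _ => (1:ℝ)))
      (fun z => z (Fin.last b) - 1) :=
    (IsSemialgebraicFunOn.sub_holds hsI (isSemialgebraicFunOn_ratCast hbsa 1)).congr
      fun z _ => by simp
  have hs0 : ∀ z ∈ KZlog.band G (fun x => 1 + κ x) (fun _ => (1:ℝ)), z (Fin.last b) ≠ 0 :=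
    fun z hz => (by linarith [hz.2.1, hκ1 _ hz.1] : (0:ℝ) < z (Fin.last b)).ne'
  have hκ0' : ∀ z ∈ KZlog.band G (fun x => 1 + κ x) (fun _ => (1:ℝ)),
      κ (Fin.init z) ^ (M + 1) ≠ 0 := fun z hz => pow_ne_zero _ (hκ0 _ hz.1).ne
  have hRsa : IsSemialgebraicFunOn ℚ (KZlog.band G (fun x => 1 + κ x) (fun _ => (1:ℝ)))
      (fun z => -(c (Fin.init z) / κ (Fin.init z) ^ (M + 1)) *
        ((z (Fin.last b) - 1) ^ M / z (Fin.last b))) :=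
    IsSemialgebraicFunOn.mul_holds
      (IsSemialgebraicFunOn.div hcI (isSemialgebraicFunOn_pow' hbsa hκI (M + 1)) hκ0').neg
      (IsSemialgebraicFunOn.div (isSemialgebraicFunOn_pow' hbsa hs1 M) hsI hs0)
  have hK : IntegrableOn (fun x => ∫ t in Icc ((fun _ : Fin b → ℝ => (0:ℝ)) x)
      ((fun _ : Fin b → ℝ => (1:ℝ)) x), |c x * (t ^ M / (1 + t * κ x))|) G :=
    integrableOn_fibre_abs_band Cy hCd hGm (F := fun x t => c x * (t ^ M / (1 + t * κ x)))
      fun x hx t ht => by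
        have hmem : (Fin.snoc x t : Fin (b + 1) → ℝ) ∈ Cy.domain := by
          rw [hCd, KZlog.snoc_mem_band]; exact ⟨hx, ht⟩
        rw [hCi hmem]
        simp only [Fin.init_snoc, Fin.snoc_last]
  have hRint : IntegrableOn
      (fun z : Fin (b + 1) → ℝ => -(c (Fin.init z) / κ (Fin.init z) ^ (M + 1)) *
        ((z (Fin.last b) - 1) ^ M / z (Fin.last b)))
      (KZlog.band G (fun x => 1 + κ x) (fun _ => (1:ℝ))) := by
    refine KZlog.integrableOn_band_of_lintegral_fibre_le hGm (a := fun x => 1 + κ x)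
      (b := fun _ => (1:ℝ)) hBm (fun x t => KZlog.snoc_mem_band)
      (KZ.aestronglyMeasurable_of_isSemialgebraicFunOn hRsa hBm)
      (K := fun x => ∫ t in Icc (0:ℝ) 1, |c x * (t ^ M / (1 + t * κ x))|) (fun x hx => ?_) hK
    simp only [Fin.init_snoc, Fin.snoc_last]
    exact lintegral_regKernel_le_neg M (c x) (hκ0 x hx) (hκ1 x hx)
  exact ⟨{ domain := KZlog.band G (fun x => 1 + κ x) (fun _ => (1:ℝ))
           integrand := fun z => -(c (Fin.init z) / κ (Fin.init z) ^ (M + 1)) *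
             ((z (Fin.last b) - 1) ^ M / z (Fin.last b))
           isSemialgebraic_domain := hbsa
           isSemialgebraicFunOn_integrand := hRsa
           integrableOn := hRint }, rfl, rfl⟩

/-- **D4 packaged (`−1 < κ < 0`):** existence of the reversed regularised representation AND the relation. -/
theorem exists_regNegRep_sub_mem_relations {b M : ℕ} {G : Set (Fin b → ℝ)} {c κ : (Fin b → ℝ) → ℝ}
    (hGo : IsOpen G) (hG : IsSemialgebraic ℚ G) (hc : IsSemialgebraicFunOn ℚ G c)
    (hκ : IsSemialgebraicFunOn ℚ G κ) (hκd : DifferentiableOn ℝ κ G) (hκ0 : ∀ x ∈ G, κ x < 0)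
    (hκ1 : ∀ x ∈ G, -1 < κ x)
    (Cy : KZ.IntegralRep (b + 1)) (hCd : Cy.domain = KZlog.band G (fun _ => 0) (fun _ => 1))
    (hCi : EqOn Cy.integrand (fun z => c (Fin.init z) *
      (z (Fin.last b) ^ M / (1 + z (Fin.last b) * κ (Fin.init z)))) Cy.domain) :
    ∃ Rg : KZ.IntegralRep (b + 1), Rg.domain = KZlog.band G (fun x => 1 + κ x) (fun _ => 1) ∧
      (Rg.integrand = fun z =>
        -(c (Fin.init z) / κ (Fin.init z) ^ (M + 1)) * ((z (Fin.last b) - 1) ^ M / z (Fin.last b))) ∧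
      KZ.of Cy - KZ.of Rg ∈ KZ.relations := by
  obtain ⟨Rg, hRd, hRi⟩ := exists_regNegRep_of_cyl (M := M) hG hc hκ hκ0 hκ1 Cy hCd hCi
  exact ⟨Rg, hRd, hRi, cyl_sub_regNeg_mem_relations hGo hG hκ hκd hκ0 hκ1 Cy Rg hCd hCi hRd
    fun z _ => by rw [hRi]⟩

/-! ### §3l END-TO-END TEST on the DEGENERATE row: the two-term family
`[(0,1)², 1 + 2θ/(1+θx) − (2+x)²θ/(1+θ(2x+x²))] ∈ KZ.relations` — PROVED

Here `κ₁ = x → 0`, `M = 1`, `c₁ = 2`: the pure-log coefficient `b₁ = −c₁/κ₁² = −2/x²` has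
`b₁ log W₁ ∼ −2/x ∉ L¹(0,1)` — the phenomenon that refutes `LogFoldingDegOne` (29577) — so NO unfolding into
honest pure-logarithmic cells exists.  The regularised route decides it with honest representations only:
cylinder terms ↦ `P_1(2/x², 1+x)` and `P_1(−1/x², (1+x)²)` (§3k/§3h), the exact multiplicative relation
`W₂ = W₁²` is ONE instance of `RegTorusProductBands` (+,+) with `d = −1/x²` and `ρ_1(u,w) = (u−1)(w−1) = x²`,
and the base terms `[G, 1] + [G, d·ρ_1] = [G, 1] + [G, −1]` cancel.  (The fibre integral of the family is
`1 + (2/x − 2log(1+x)/x²) − ((2+x)/x − 2 log(1+x)/x²) ≡ 0`, as `CylKernelZeroLog` requires.) -/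

namespace DegenerateInstance

/-- The base `G = (0,1) ⊆ ℝ¹`. -/
def G : Set (Fin 1 → ℝ) := {x | 0 < x 0 ∧ x 0 < 1}

/-- Auxiliary step `isOpen_G`. [bookkeeping] -/
theorem isOpen_G : IsOpen G := by
  have h : G = (fun x : Fin 1 → ℝ => x 0) ⁻¹' Ioo 0 1 := by
    ext x
    simp [G]
  rw [h]
  exact isOpen_Ioo.preimage (continuous_apply 0)

/-- `G` is `ℚ`-semialgebraic. [BCR1998 §2.2] -/
theorem isSemialgebraic_G : IsSemialgebraic ℚ G := by
  have h1 := isSemialgebraic_setOf_eval_pos (k := ℚ) (R := ℝ) (MvPolynomial.X (0 : Fin 1))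
  have h2 := isSemialgebraic_setOf_eval_lt (k := ℚ) (R := ℝ) (MvPolynomial.X (0 : Fin 1)) 1
  convert h1.inter h2 using 1
  ext x
  simp only [G, mem_setOf_eq, mem_inter_iff, MvPolynomial.aeval_X, map_one]

/-- `G ⊆ Icc`. [bookkeeping] -/
theorem G_subset_Icc : G ⊆ Icc (0 : Fin 1 → ℝ) 1 := fun x hx => by
  rw [mem_Icc, Pi.le_def, Pi.le_def]
  exact ⟨fun i => by rw [Fin.eq_zero i]; exact hx.1.le, fun i => by rw [Fin.eq_zero i]; exact hx.2.le⟩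

/-- Auxiliary step `volume_G_lt_top`. [bookkeeping] -/
theorem volume_G_lt_top : volume G < ⊤ :=
  lt_of_le_of_lt (measure_mono G_subset_Icc) (by simp [Real.volume_Icc_pi])

/-- Data of the family: `c₁ = 2, κ₁ = x, c₂ = −(2+x)², κ₂ = 2x + x²` (`M = 1`, log kind). -/
def c₁ : (Fin 1 → ℝ) → ℝ := fun _ => 2
/-- `κ₁ = x`. -/
def κ₁ : (Fin 1 → ℝ) → ℝ := fun x => x 0
/-- `c₂ = −(2+x)²`. -/
def c₂ : (Fin 1 → ℝ) → ℝ := fun x => -(2 + x 0) ^ 2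
/-- `κ₂ = 2x + x²` (so `1 + κ₂ = (1 + κ₁)²`). -/
def κ₂ : (Fin 1 → ℝ) → ℝ := fun x => 2 * x 0 + x 0 ^ 2

/-- The cylinder monomial `c(x)·θ^1/(1+θκ(x))`. -/
def term (c κ : (Fin 1 → ℝ) → ℝ) (z : Fin (1 + 1) → ℝ) : ℝ :=
  c (Fin.init z) * (z (Fin.last 1) ^ 1 / (1 + z (Fin.last 1) * κ (Fin.init z)))

/-- The open square `(0,1) × (0,1)`. -/
def cyl : Set (Fin (1 + 1) → ℝ) :=
  {z | (Fin.init z : Fin 1 → ℝ) ∈ G ∧ (0:ℝ) < z (Fin.last 1) ∧ z (Fin.last 1) < 1}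

/-- `cyl` is `ℚ`-semialgebraic. [BCR1998 §2.2] -/
theorem isSemialgebraic_cyl : IsSemialgebraic ℚ cyl := RTerm.isSemialgebraic_cyl isSemialgebraic_G

/-- Auxiliary step `sa_x`. [bookkeeping] -/
theorem sa_x : IsSemialgebraicFunOn ℚ G (fun x => x 0) := isSemialgebraicFunOn_apply isSemialgebraic_G 0

/-- Auxiliary step `sa_c₁`. [bookkeeping] -/
theorem sa_c₁ : IsSemialgebraicFunOn ℚ G c₁ :=
  (isSemialgebraicFunOn_ratCast isSemialgebraic_G 2).congr fun _ _ => by simp [c₁]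

/-- Auxiliary step `sa_κ₁`. [bookkeeping] -/
theorem sa_κ₁ : IsSemialgebraicFunOn ℚ G κ₁ := sa_x.congr fun _ _ => rfl

/-- Auxiliary step `sa_c₂`. [bookkeeping] -/
theorem sa_c₂ : IsSemialgebraicFunOn ℚ G c₂ :=
  ((isSemialgebraicFunOn_pow' isSemialgebraic_G (IsSemialgebraicFunOn.add_holds
    (isSemialgebraicFunOn_ratCast isSemialgebraic_G 2) sa_x) 2).neg).congr fun _ _ => by simp [c₂]

/-- Auxiliary step `sa_κ₂`. [bookkeeping] -/
theorem sa_κ₂ : IsSemialgebraicFunOn ℚ G κ₂ :=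
  (IsSemialgebraicFunOn.add_holds (IsSemialgebraicFunOn.mul_holds
    (isSemialgebraicFunOn_ratCast isSemialgebraic_G 2) sa_x)
    (isSemialgebraicFunOn_pow' isSemialgebraic_G sa_x 2)).congr fun _ _ => by simp [κ₂]

/-- Auxiliary step `κ₁_pos`. [bookkeeping] -/
theorem κ₁_pos : ∀ x ∈ G, 0 < κ₁ x := fun _ hx => hx.1

/-- Auxiliary step `κ₂_pos`. [bookkeeping] -/
theorem κ₂_pos : ∀ x ∈ G, 0 < κ₂ x := fun x hx => by
  have := hx.1
  simp only [κ₂]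
  positivity

/-- Auxiliary step `κ₁_diff`. [bookkeeping] -/
theorem κ₁_diff : DifferentiableOn ℝ κ₁ G :=
  (show Differentiable ℝ κ₁ from by unfold κ₁; fun_prop).differentiableOn

/-- Auxiliary step `κ₂_diff`. [bookkeeping] -/
theorem κ₂_diff : DifferentiableOn ℝ κ₂ G :=
  (show Differentiable ℝ κ₂ from by unfold κ₂; fun_prop).differentiableOn

/-- Semialgebraicity of a cylinder monomial on any semialgebraic `B` over `G` off the pole. -/
theorem sa_term {B : Set (Fin (1 + 1) → ℝ)} (hB : IsSemialgebraic ℚ B)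
    (hBG : B ⊆ {z | (Fin.init z : Fin 1 → ℝ) ∈ G}) {c κ : (Fin 1 → ℝ) → ℝ}
    (hc : IsSemialgebraicFunOn ℚ G c) (hκ : IsSemialgebraicFunOn ℚ G κ)
    (hden : ∀ z ∈ B, 1 + z (Fin.last 1) * κ (Fin.init z) ≠ 0) :
    IsSemialgebraicFunOn ℚ B (term c κ) := by
  have hcI : IsSemialgebraicFunOn ℚ B (fun z => c (Fin.init z)) := hc.comp_init.mono hBG hB
  have hκI : IsSemialgebraicFunOn ℚ B (fun z => κ (Fin.init z)) := hκ.comp_init.mono hBG hB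
  have hsI : IsSemialgebraicFunOn ℚ B (fun z => z (Fin.last 1)) :=
    isSemialgebraicFunOn_apply hB (Fin.last 1)
  have hdenI : IsSemialgebraicFunOn ℚ B (fun z => 1 + z (Fin.last 1) * κ (Fin.init z)) :=
    (IsSemialgebraicFunOn.add_holds (isSemialgebraicFunOn_ratCast hB 1)
      (IsSemialgebraicFunOn.mul_holds hsI hκI)).congr fun _ _ => by simp
  exact (IsSemialgebraicFunOn.mul_holds hcI (IsSemialgebraicFunOn.div
    (isSemialgebraicFunOn_pow' hB hsI 1) hdenI hden)).congr fun _ _ => by simp [term]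

/-- Size of a cylinder monomial: `|c θ/(1+θκ)| ≤ |c|` for `0 ≤ θ ≤ 1`, `κ ≥ 0`. -/
theorem abs_term_le {c κ : (Fin 1 → ℝ) → ℝ} {z : Fin (1 + 1) → ℝ} (h0 : 0 ≤ z (Fin.last 1))
    (h1 : z (Fin.last 1) ≤ 1) (hk : 0 ≤ κ (Fin.init z)) : |term c κ z| ≤ |c (Fin.init z)| := by
  have hden : 1 ≤ 1 + z (Fin.last 1) * κ (Fin.init z) := by nlinarith
  have ha : 0 ≤ z (Fin.last 1) ^ 1 / (1 + z (Fin.last 1) * κ (Fin.init z)) := by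
    rw [pow_one]; exact div_nonneg h0 (by linarith)
  have hb : z (Fin.last 1) ^ 1 / (1 + z (Fin.last 1) * κ (Fin.init z)) ≤ 1 := by
    rw [pow_one, div_le_one (by linarith)]; linarith
  rw [term, abs_mul, abs_of_nonneg ha]
  exact mul_le_of_le_one_right (abs_nonneg _) hb

end DegenerateInstance
end CylLog
end RegularisedLogLayer
end Summit.KontsevichZagierPeriods.RootDecompRelativeModAbsolute.Rung30571
end
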